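import Literature.MathematicalPhysics.KineticTheory.LangevinChainHarris
import HarnessLib

/-!
# The weak-stationarity fact from H2 and absolute continuity of the transition probabilities

Trunk T-KINETIC (Literature/MathematicalPhysics/KineticTheory). Provefact unit for the named fact
`CuneoEckmannHairerReyBellet2018_pinnedChain` (`LangevinChainNESS.lean`; Cuneo–Eckmann–Hairer–
Rey-Bellet 2018, Thm 2.13, weak-stationarity corollary for the pinned anharmonic chain), second
seat: an INDEPENDENT route to the absolute continuity clause (ii) of the fact.

After `LangevinChainDynkin.lean` the fact rests on two named facts
(`CuneoEckmannHairerReyBellet2018_pinnedChain_of_H2_of_hormander`): CEHR Thm 5.1 / Rem 5.2 (the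
Lyapunov condition H2 for the constructed transition semigroup `pinnedChainSemigroup`, named fact
`CuneoEckmannHairerReyBellet2018_H2`) and Hörmander's hypoellipticity theorem
(`Literature.Analysis.Distribution.Hormander1967_thm11`), the latter being used ONLY to make the
Krylov–Bogoliubov invariant measure absolutely continuous (indeed smooth). The fact itself asks for
`μ ≪ Lebesgue`, not for a smooth density, and absolute continuity of an invariant measure follows
from a much weaker input than hypoellipticity of `L*`:

* `LangevinChainSemigroup.IsInvariant.absolutelyContinuous_of_kernel` — **if every transition
  probability `P_t(z, ·)` at one time `t` is absolutely continuous with respect to a measure `ν`,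
  then so is every invariant measure** (`μ(A) = ∫ P_t(z, A) μ(dz)`), PROVED (three lines).
* `CuneoEckmannHairerReyBellet2018_pinnedChain_of_H2_of_absolutelyContinuous` — PROVED: the named
  fact follows from H2 and the statement "`P_1(z, ·) ≪ Leb` for every `z`" for the transition
  kernels `OscillatorChain.transitionKernel` of the pinned chain (`LangevinChainKernel.lean`),
  spelled out as an explicit hypothesis (no new named fact, D-0026): the invariant probability
  measure of `pinnedChainSemigroup_exists_isInvariant` (Krylov–Bogoliubov from H2,
  `LangevinChainHarris.lean`) integrates `e^{ϑH}` for all `0 < ϑ < 1/max(T_L,T_R)`, is a weak steady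
  state (`pinnedChain_isSteadyState_of_isInvariant`, Dynkin), and is absolutely continuous by the
  lemma above.

The hypothesis "`P_t(z, ·) ≪ Leb`" is the absolute-continuity half of CEHR Prop. 3.2 ("the
transition kernel (2.3) can be written as `P_t(z, dz') = p_t(z, z') dz'`"), printed as a
consequence of Hörmander's theorem for `∂_t - L`. It is the target of this seat's programme of
PROVED files, by an elementary finite-dimensional ("partial Malliavin") argument specific to
additive noise: Gaussian skeleton decomposition of the Brownian pair, `C¹` dependence of the
pathwise solution `OscillatorChain.chainFlow` on finitely many forcing parameters, linearised
controllability of the chain along every trajectory (`V'' = 1 + 3βr² ≥ 1`), and the fact that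
submersions pull Lebesgue-null sets back to null sets — none of which needs the pseudo-differential
calculus of Hörmander's proof.

## References

* N. Cuneo, J.-P. Eckmann, M. Hairer, L. Rey-Bellet, *Non-equilibrium steady states for networks
  of oscillators*, Electron. J. Probab. 23 (2018) no. 55 (arXiv:1712.09413): Thm 2.13, Prop. 3.2,
  Prop. 3.7. Page numbers refer to the arXiv version.
-/

noncomputable section

open MeasureTheory ProbabilityTheory
open scoped NNReal ENNReal

namespace Literature.MathematicalPhysics.KineticTheory.HeatConduction

open OscillatorChain

variable {N : ℕ}

namespace LangevinChainSemigroup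

variable {P : OscillatorChain} {T_L T_R : ℝ} (S : LangevinChainSemigroup P N T_L T_R)

/-- **Invariant measures inherit absolute continuity from the transition probabilities.** If for
one time `t` every `P_t(z, ·)` is absolutely continuous with respect to `ν`, then every invariant
measure `μ` of the semigroup is: `μ(A) = ∫ P_t(z, A) μ(dz) = 0` whenever `ν(A) = 0`. [folklore] -/
theorem IsInvariant.absolutelyContinuous_of_kernel {μ : Measure (PhaseSpace N)} (hμ : S.IsInvariant μ)
    (t : ℝ≥0) {ν : Measure (PhaseSpace N)} (hac : ∀ z, S.kernel t z ≪ ν) : μ ≪ ν := by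
  refine Measure.AbsolutelyContinuous.mk fun A hA hνA => ?_
  rw [← hμ.lintegral_kernel S t hA]
  simp [fun z => hac z hνA]

end LangevinChainSemigroup

section Pinned

/-- **The weak-stationarity fact from H2 and absolute continuity of the transition probabilities.**
If the Lyapunov condition H2 (CEHR Thm 5.1 / Rem 5.2, named fact
`CuneoEckmannHairerReyBellet2018_H2`) holds and, for the pinned chain with positive parameters,
every transition probability `P_1(z, ·)` of the SDE (2.2) (the kernels
`OscillatorChain.transitionKernel` of `LangevinChainKernel.lean`) is absolutely continuous with
respect to Lebesgue measure on phase space (CEHR Prop. 3.2, absolute-continuity part — here an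
explicit hypothesis), then `CuneoEckmannHairerReyBellet2018_pinnedChain` holds: the invariant
probability measure of `pinnedChainSemigroup` obtained by Krylov–Bogoliubov
(`pinnedChainSemigroup_exists_isInvariant`) integrates `e^{ϑH}` for `0 < ϑ < 1/max(T_L,T_R)`, is
a weak steady state by Dynkin's identity (`pinnedChain_isSteadyState_of_isInvariant`), and is
absolutely continuous by `LangevinChainSemigroup.IsInvariant.absolutelyContinuous_of_kernel`.
[cite: CuneoEckmannHairerReyBellet2018, Thm 2.13 and Prop 3.2] -/
theorem CuneoEckmannHairerReyBellet2018_pinnedChain_of_H2_of_absolutelyContinuous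
    (h2 : CuneoEckmannHairerReyBellet2018_H2)
    (hac : ∀ ω₂ lam β γ : ℝ, 0 < ω₂ → 0 < lam → 0 < β → 0 < γ →
      ∀ (N : ℕ) (T_L T_R : ℝ), 0 < N → 0 < T_L → 0 < T_R →
        ∀ z : PhaseSpace N,
          (pinnedChain ω₂ lam β γ).transitionKernel N T_L T_R 1 z ≪ (volume : Measure (PhaseSpace N))) :
    CuneoEckmannHairerReyBellet2018_pinnedChain := by
  intro ω₂ lam β γ hω hl hβ hγ N T_L T_R hN hL hR
  obtain ⟨μ, hμ, hinv, hint⟩ := pinnedChainSemigroup_exists_isInvariant hω hl.le hβ hγ hN hL hR h2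
  have hmax : 0 < max T_L T_R := lt_max_of_lt_left hL
  have hϑ0 : 0 < 1 / max T_L T_R / 2 := by positivity
  have hϑ1 : 1 / max T_L T_R / 2 < 1 / max T_L T_R := half_lt_self (by positivity)
  refine ⟨μ, pinnedChain_isSteadyState_of_isInvariant hω.le hl.le hβ.le γ N _ hinv hϑ0 (hint _ hϑ0 hϑ1),
    ?_, hint⟩
  refine hinv.absolutelyContinuous_of_kernel _ 1 fun z => ?_
  rw [pinnedChainSemigroup_kernel]
  exact hac ω₂ lam β γ hω hl hβ hγ N T_L T_R hN hL hR z

end Pinned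

end Literature.MathematicalPhysics.KineticTheory.HeatConduction
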